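import Summits.QuantumFields.YangMills.Theorems.BalabanUVNodesN13U1StepPieceCountAtRecord13CoPH

/-!
# BalabanUVNodes ∕ N13 — THE (0.2) PIECE-TO-PIECE STEP AT NODE 00's STAGE-13 RECORD: [IV] (0.3) *«the operation 𝐑𝐓 applied to each term ρ_k(Z,·)»* IN KERNEL FORM
# (Track A, DAG node N13 = [B16]; cluster K1 — K1⁷ `StabilityBAtRecordR13SepCoPH` = stmt-QuantumFields-20542, helper; seat `pub-ymgap-dag-n13-w6` g2, own-stem successor of
# `…N13U1StepPieceCountAtRecord13CoPH` (p610171); 2026-08-28; count-neutral)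

HONEST FRAMING.  Count-neutral kernel BOOKKEEPING + [folklore] finite combinatorics ∕ measure theory; nothing of Bałaban's is asserted.  p610171 bounded the level-(k+1) piece
`ρ_{k+1}(Z′,·)` of the density of record from a level-`k` majorant PER HISTORY `s` (total-mass letter `B(s)`, summed over all histories).  THIS FILE bounds it from the level-`k`
PIECES `ρ_k(Z,·) = Σ_{s : Λ_k(s)ᶜ = Z} χ_k(s)·slot_k(s)` THEMSELVES, kept INSIDE the one-step transport: for every coarse field `V′`,
`|ρ_{k+1}(Z′,V′)| ≤ Σ_Z Σ_{q = (Ω_{k+1},Λ_{k+1}) admissible after Zᶜ, Λ_{k+1}ᶜ = Z′} X(q)(V′)·C(Z,q)(V′)·T_k(W(Z,q)(·,V′)·ρ_k(Z,·))(V′)` (★★★ `abs_pieceOfRecord_succ_le_sum_lastRegion_transport_piece`),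
i.e. the level-`k` input is a sum over LAST REGIONS `Z` (not over histories) and stays under the averaging `T_k` — [IV] (0.2)–(0.3)'s shape: *«ρ(V) = Σ_Z ρ(Z,V) … the operation 𝐑
applied to each term»*.  The regrouping is r11 ∕ n22-b bookkeeping: the (2.18) index of length `k+1` with prescribed `Λ_{k+1}ᶜ = Z′` is re-indexed by the old history `s` and the new
pair (p610171's `sum_filter_lastRegion_eq_sum_extPair`), then by `Z := Λ_k(s)ᶜ` and the `s`-FREE pair index `{q | q.1, q.2 ∈ 𝐃_{k+1}, q.2 ⊆ q.1, (1 ≤ k → q.1 ⊆ Zᶜ)}` (n22-b's `ExtPair`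
predicate with `Λ_k(s) ↦ Zᶜ`; `sum_extPair_eq_sum_lastRegion_pairs`), and the sum over the old histories with `Λ_k(s)ᶜ = Z` is carried INSIDE the integral against the conditional law by
linearity (`transportOfRecord_mul_sum`) — which is where the old histories stop being counted one by one.  The ROWS (displayed unless said otherwise): (r1) the level-`k` history terms are
`≥ 0` — DISCHARGED at the record by dag-n13-w1's `histTerm_nonneg` (ζ-laws of `Provisos₁₃CoPH`); (r2) they are measurable in the fine field (suppliers under their located hypotheses:
def-T `Record9ProvisosOfRegularity.slotsOfRecord_measurable_and_bounded` ∕ `Record12Measurability`; needed for `Σ_s ∫ = ∫ Σ_s`); (r3) `|w_k(s.snoc e)(U,V′)| ≤ W(Λ_k(s)ᶜ, e)(U,V′)` with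
`0 ≤ W ≤ 1` measurable in `U` — «the step weights read the old history through `Λ_k` only», an INEQUALITY row (`W := 1` inhabits it by `absW_le`; the sharp instance is a def-T-side
structure fact about `wOfRecord = resumWeights σOfRecord ωOfRecord`, whose `s`-dependence runs through `guardΩ`, `cubes32`, `sect3DataOfRecord`, `qcubes` and the residual `θ.ζ` —
LOCATED, not proved here); (r4) `χ_{k+1}(s.snoc e)(V′) ≤ X(e)(V′)` — inhabited WITH EQUALITY: `chiSeqOfRecord` reads `Ω_{k+1}` only (★ `chiSeqOfRecord_snoc_eq_of_fst_eq`, PROVED);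
(r5) the 𝐑-ratio row `|slot_{k+1}(s′)| ≤ c_R(s′)·|slotT_{k+1}(s′)|` with `c_R(s.snoc e) ≤ C(Λ_k(s)ᶜ, e)` ([IV] (0.3); `C := 1` at live selectors, dag-n13-w3's
`…N13U1StepRRatioRowAtRecord13CoPH`); (r6) the level-`k` pieces are bounded (`∃ C_Z, ρ_k(Z,·) ≤ C_Z`; any majorant tower).  (U1) NOT proved; [III] Cor. 3 NOT proved; N13 NOT
discharged; K0⁷ ∕ K1⁷ NOT closed; counts unmoved (discharged 5∕27 · Track A 5∕28).  ONE finite four-torus programme at fixed `ε = L^{−K}`; R4 closes the conditional finite-𝕋⁴ rung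
`BalabanLadder.UV` only — the Yang–Mills mass gap (Clay) is NOT proved by any of this; nothing continuum ∕ ℝ⁴ ∕ OS.  No `sorry`, `def`, `instance`, `notation`.

WHAT THIS FILE PROVES.
§1 [folklore] over r11's (2.18) index: `sum_extPair_eq_sum_lastRegion_pairs` (re-indexing `Σ_s Σ_{e : ExtPair s}` by the old last region `Z = Λ_k(s)ᶜ` and the `s`-free pair index),
   `sum_pairs_lastRegion_pow_lf_le_exp` (p610171's `Ω_{k+1}`-count on the `s`-free index).
§2 generic over the represented tower of record (S1 §2's letters): ★ `chiSeqOfRecord_snoc_eq_of_fst_eq` ((r4) with equality), `transportOfRecord_mul_sum` (linearity of the transport over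
   a finite sum of bounded measurable non-negative terms), `abs_pieceOfRecord_succ_le_sum_extPair_abs_slotsT` (the piece at level k+1 against `|slotT_{k+1}|`, regrouped),
   ★★★ `abs_pieceOfRecord_succ_le_sum_lastRegion_transport_piece` (THE PIECE-TO-PIECE STEP).
§3 at K1⁷'s record: ★★★ `abs_pieceOfRecord₁₃_succ_le_sum_lastRegion_transport_piece` ((r1) discharged by `histTerm_nonneg`; (r2)–(r6) displayed).

Sources: [Balaban1989LargeFieldI] (0.2)–(0.4) p.176, p.175; [Balaban1988Convergent] (2.1) p.254, (2.18) p.257, (3.1) p.264, §3 p.267, (3.24)–(3.25) p.270, (2.49) p.264;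
[Balaban1989LargeFieldII] (1.89) p.387; [Balaban1982Higgs2] (3.46) p.593 (cite only).
-/

noncomputable section

open MeasureTheory
open scoped BigOperators

namespace Summit.QuantumFields.YangMills.BalabanUVNodes.N13U1PieceToPieceStepAtRecord13CoPH

open Literature.MathematicalPhysics.QuantumFieldTheory.Balaban1983to89
open T4Continuum Node00 B14.Eq218Concrete
open T4AveragingDisintegration (transportK kernelTransport avgKernel)
open Summit.QuantumFields.YangMills.BalabanUVNodes.N13Cor3LastRegionCountAtRecord13CoPH (classSum_pow_lf_le_exp)
open Summit.QuantumFields.YangMills.BalabanUVNodes.N13U1StepMajorantTowerAtRecord13CoPH (abs_transportOfRecord_le)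
open Summit.QuantumFields.YangMills.BalabanUVNodes.N13U1StepPieceCountAtRecord13CoPH (sum_filter_lastRegion_eq_sum_extPair)
open Summit.QuantumFields.YangMills.BalabanUVNodes.N13UVChiOffSolvableAtRecord13 (histTerm_nonneg)

/-! ## §1. Re-indexing by the old last region and the `s`-free pair index; the `Ω_{k+1}`-count on that index [folklore] -/

section Regrouping

variable {α : Type*} [Fintype α] {D : ℕ → Set (Set α)} {k : ℕ}

open Classical in
/-- **RE-INDEXING BY THE OLD LAST REGION AND THE `s`-FREE PAIR INDEX** [folklore]: a double sum over the admissible sequences `s` of length `k` and the new admissible pairs `e` after `s`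
selected by a property `P` of the underlying pair, whose summand reads `s` and the pair, equals the sum over the old last regions `Z = Λ_k(s)ᶜ`, the pairs `q = (Ω_{k+1}, Λ_{k+1})` with
`q.1, q.2 ∈ 𝐃_{k+1}`, `q.2 ⊆ q.1`, `(1 ≤ k → q.1 ⊆ Zᶜ)` (n22-b's `ExtPair` predicate with `Λ_k(s) ↦ Zᶜ`) and `P q`, and the old histories with `Λ_k(s)ᶜ = Z`
(`Finset.sum_map` along `Function.Embedding.subtype`, `Finset.sum_fiberwise`, `Finset.sum_comm`). [cite: Balaban1988Convergent, (2.1) p.254, (2.18) p.257, §3 p.267, p.270 (bookkeeping); Balaban1989LargeFieldI, (0.2) p.176] -/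
theorem sum_extPair_eq_sum_lastRegion_pairs [∀ s : Seq D k, Fintype (Seq.ExtPair D k s)] {M : Type*} [AddCommMonoid M]
    (g : Set α → Seq D k → Set α × Set α → M) (P : Set α × Set α → Prop) :
    ∑ s : Seq D k, ∑ e ∈ Finset.univ.filter (fun e : Seq.ExtPair D k s => P e.1), g ((s.Λ k)ᶜ) s e.1
      = ∑ Z : Set α, ∑ q ∈ Finset.univ.filter (fun q : Set α × Set α =>
            (q.1 ∈ D (k + 1) ∧ q.2 ∈ D (k + 1) ∧ q.2 ⊆ q.1 ∧ (1 ≤ k → q.1 ⊆ Zᶜ)) ∧ P q),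
          ∑ s ∈ Finset.univ.filter (fun s : Seq D k => (s.Λ k)ᶜ = Z), g Z s q := by
  -- (1) per `s`: the pairs after `s` selected by `P` are the `s`-free pairs satisfying the `ExtPair` predicate and `P`
  have h1 : ∀ s : Seq D k,
      ∑ e ∈ Finset.univ.filter (fun e : Seq.ExtPair D k s => P e.1), g ((s.Λ k)ᶜ) s e.1
        = ∑ q ∈ Finset.univ.filter (fun q : Set α × Set α =>
            (q.1 ∈ D (k + 1) ∧ q.2 ∈ D (k + 1) ∧ q.2 ⊆ q.1 ∧ (1 ≤ k → q.1 ⊆ s.Λ k)) ∧ P q), g ((s.Λ k)ᶜ) s q := by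
    intro s
    have hmap : (Finset.univ.filter (fun e : Seq.ExtPair D k s => P e.1)).map (Function.Embedding.subtype _)
        = Finset.univ.filter (fun q : Set α × Set α =>
            (q.1 ∈ D (k + 1) ∧ q.2 ∈ D (k + 1) ∧ q.2 ⊆ q.1 ∧ (1 ≤ k → q.1 ⊆ s.Λ k)) ∧ P q) := by
      ext q
      simp only [Finset.mem_map, Finset.mem_filter, Finset.mem_univ, true_and, Function.Embedding.coe_subtype]
      constructor
      · rintro ⟨e, hP, rfl⟩
        exact ⟨e.2, hP⟩
      · rintro ⟨hA, hP⟩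
        exact ⟨⟨q, hA⟩, hP, rfl⟩
    rw [← hmap, Finset.sum_map]
    rfl
  simp_rw [h1]
  -- (2) group the old histories by their last region `Z = Λ_k(s)ᶜ`, rewrite the predicate on each fibre, and swap
  rw [← Finset.sum_fiberwise Finset.univ (fun s : Seq D k => (s.Λ k)ᶜ)]
  refine Finset.sum_congr rfl fun Z _ => ?_
  rw [Finset.sum_comm]
  refine Finset.sum_congr rfl fun s hs => ?_
  rw [Finset.mem_filter] at hs
  have hZ : (s.Λ k)ᶜ = Z := hs.2
  have hΛ : s.Λ k = Zᶜ := by rw [← hZ, compl_compl]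
  rw [hZ, hΛ]

open Classical in
/-- **THE `Ω_{k+1}`-COUNT ON THE `s`-FREE PAIR INDEX** [folklore] (p610171's `sum_extPair_lastRegion_pow_lf_le_exp` re-indexed): at prescribed last region `q.2ᶜ = Z′`, over the pairs
`q` with `q.1, q.2 ∈ 𝐃_{k+1}` (unions of cubes of a finite family `I`), `q.2 ⊆ q.1` and the chain condition, `Σ_q x^{#I-cubes ⊄ q.1} ≤ exp(x·|I|)` for `x ≥ 0` — the pairs inject into
`𝐃_{k+1}` by their first domain, then F1's `classSum_pow_lf_le_exp`. [cite: Balaban1988Convergent, §3 p.267; Balaban1982Higgs2, (3.46) p.593 (cite only)] -/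
theorem sum_pairs_lastRegion_pow_lf_le_exp {ι : Type*} (I : Finset ι) (cube : ι → Set α)
    (hD : ∀ S ∈ D (k + 1), ∃ A : Finset ι, A ⊆ I ∧ S = ⋃ a ∈ A, cube a) {x : ℝ} (hx : 0 ≤ x) (Z Z' : Set α) :
    ∑ q ∈ Finset.univ.filter (fun q : Set α × Set α =>
        (q.1 ∈ D (k + 1) ∧ q.2 ∈ D (k + 1) ∧ q.2 ⊆ q.1 ∧ (1 ≤ k → q.1 ⊆ Zᶜ)) ∧ (q.2)ᶜ = Z'),
        x ^ Set.ncard {c | c ∈ I ∧ ¬ cube c ⊆ q.1} ≤ Real.exp (x * I.card) := by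
  have hinj : Set.InjOn (fun q : Set α × Set α => q.1)
      ↑(Finset.univ.filter (fun q : Set α × Set α =>
        (q.1 ∈ D (k + 1) ∧ q.2 ∈ D (k + 1) ∧ q.2 ⊆ q.1 ∧ (1 ≤ k → q.1 ⊆ Zᶜ)) ∧ (q.2)ᶜ = Z')) := by
    intro q hq q' hq' h
    rw [Finset.coe_filter] at hq hq'
    exact Prod.ext h (compl_injective (hq.2.2.trans hq'.2.2.symm))
  rw [← Finset.sum_image (f := fun S : Set α => x ^ Set.ncard {c | c ∈ I ∧ ¬ cube c ⊆ S}) hinj]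
  refine classSum_pow_lf_le_exp I cube _ (fun S hS => ?_) hx
  rw [Finset.mem_image] at hS
  obtain ⟨q, hq, rfl⟩ := hS
  rw [Finset.mem_filter] at hq
  exact hD q.1 hq.2.1.1

end Regrouping

/-! ## §2. GENERIC OVER THE REPRESENTED TOWER OF RECORD: (r4) with equality, linearity of the transport, and THE PIECE-TO-PIECE STEP -/

section Tower

variable (F : T4Family) (N : ℕ) [NeZero N] (ν : Stage7Numerics) (τ : TowerNumerics)
variable (E : B12.RunParams → ℝ) (w : StepWeightsOfRecord F N ν τ.M) (ppSel : PpSelOfRecord F ν τ.M) (p : B12.RunParams) (g : ℕ → ℝ)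

/-- **(r4) WITH EQUALITY: `χ_{k+1}` READS `Ω_{k+1}` ONLY** [PROVED]: def-R's pinned front factor `chiSeqOfRecord … (k+1) s′` is r11's `chi218 … (k+1) s′ = chi217 … (cubesIn cube (Ω_{k+1}(s′)))`,
so two appended indices with the same new first domain have the same `χ_{k+1}` — the row `χ_{k+1}(s.snoc e) ≤ X(e)` is inhabited by the value itself.
[cite: Balaban1988Convergent, (2.17)–(2.18) p.257 (bookkeeping)] -/
theorem chiSeqOfRecord_snoc_eq_of_fst_eq (k : ℕ) (s₁ s₂ : SeqOfRecord F ν τ.M g p.K k)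
    (e₁ : Seq.ExtPair (DOfRecord F ν τ.M g p.K) k s₁) (e₂ : Seq.ExtPair (DOfRecord F ν τ.M g p.K) k s₂) (h : e₁.1.1 = e₂.1.1) :
    chiSeqOfRecord F N ν τ.M g p.K (k + 1) (s₁.snoc e₁) = chiSeqOfRecord F N ν τ.M g p.K (k + 1) (s₂.snoc e₂) := by
  unfold chiSeqOfRecord chi218
  rw [Seq.snoc_Ω_succ, Seq.snoc_Ω_succ, h]

/-- **LINEARITY OF THE TRANSPORT OF RECORD OVER A FINITE SUM** [folklore]: for a family `f_i ≥ 0` of measurable functions with `Σ_{i∈S} f_i ≤ C` and a measurable weight `0 ≤ W ≤ 1`,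
`T_k(W·Σ_{i∈S} f_i) = Σ_{i∈S} T_k(W·f_i)` — every `W·f_i` is bounded measurable, hence integrable against the conditional law (a finite measure), and `integral_finsetSum`.
[cite: Balaban1988Convergent, (3.1) p.264 (bookkeeping: the δ-function integral read as the tree's disintegration kernel)] -/
theorem transportOfRecord_mul_sum {ι : Type*} (K k : ℕ) (S : Finset ι) (f : ι → GaugeField (F.P K) k (SU N) → ℝ)
    (hf0 : ∀ i U, 0 ≤ f i U) (hfm : ∀ i, Measurable (f i)) {C : ℝ} (hfC : ∀ U, ∑ i ∈ S, f i U ≤ C)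
    {W : GaugeField (F.P K) k (SU N) → ℝ} (hWm : Measurable W) (hW0 : ∀ U, 0 ≤ W U) (hW1 : ∀ U, W U ≤ 1)
    (V' : GaugeField (F.P K) (k + 1) (SU N)) :
    transportOfRecord F N K k (fun U => W U * ∑ i ∈ S, f i U) V' = ∑ i ∈ S, transportOfRecord F N K k (fun U => W U * f i U) V' := by
  simp only [transportOfRecord, transportK, kernelTransport]
  rw [← Finset.mul_sum]
  congr 1
  have hint : ∀ i ∈ S, Integrable (fun U => W U * f i U) (avgKernel (avOfRecord F N K k).avg V') := by
    intro i hi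
    refine Integrable.of_bound (hWm.mul (hfm i)).aestronglyMeasurable C (ae_of_all _ fun U => ?_)
    rw [Real.norm_eq_abs, abs_of_nonneg (mul_nonneg (hW0 U) (hf0 i U))]
    calc W U * f i U ≤ 1 * f i U := mul_le_mul_of_nonneg_right (hW1 U) (hf0 i U)
      _ = f i U := one_mul _
      _ ≤ ∑ j ∈ S, f j U := Finset.single_le_sum (fun j _ => hf0 j U) hi
      _ ≤ C := hfC U
  rw [← integral_finsetSum S hint]
  refine integral_congr_ae (ae_of_all _ fun U => ?_)
  simp only [Finset.mul_sum]

open Classical in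
/-- **THE PIECE AT LEVEL k+1 AGAINST `|slotT_{k+1}|`, REGROUPED BY NEW PAIRS**: `|ρ_{k+1}(Z′,V′)| ≤ Σ_s Σ_{e : Λ_{k+1}(e)ᶜ = Z′} χ_{k+1}(s.snoc e)(V′)·c_R(s.snoc e)(V′)·|slotT_{k+1}(s.snoc e)(V′)|`
from the 𝐑-ratio row (r5) alone (`|χ·slot| = χ·|slot|`, `χ_{k+1} ≥ 0`; p610171's `sum_filter_lastRegion_eq_sum_extPair`).  Nothing of Bałaban's asserted.
[cite: Balaban1989LargeFieldI, (0.2)–(0.3) p.176; Balaban1988Convergent, §3 p.267, p.270] -/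
theorem abs_pieceOfRecord_succ_le_sum_extPair_abs_slotsT (k : ℕ) (Z' : Set (Site (F.P p.K) 0)) (V' : GaugeField (F.P p.K) (k + 1) (SU N))
    [∀ s : SeqOfRecord F ν τ.M g p.K k, Fintype (Seq.ExtPair (DOfRecord F ν τ.M g p.K) k s)]
    (cR : SeqOfRecord F ν τ.M g p.K (k + 1) → GaugeField (F.P p.K) (k + 1) (SU N) → ℝ)
    (hR : ∀ s', |slotsOfRecord F N ν τ E w ppSel p g (k + 1) s' V'| ≤ cR s' V' * |slotsTOfRecord F N ν τ E w ppSel p g (k + 1) s' V'|) :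
    |pieceOfRecord F N ν τ.M (slotsOfRecord F N ν τ E w ppSel) p g (k + 1) Z' V'|
      ≤ ∑ s : SeqOfRecord F ν τ.M g p.K k, ∑ e ∈ Finset.univ.filter
          (fun e : Seq.ExtPair (DOfRecord F ν τ.M g p.K) k s => (e.1.2)ᶜ = Z'),
          chiSeqOfRecord F N ν τ.M g p.K (k + 1) (s.snoc e) V' * cR (s.snoc e) V' *
            |slotsTOfRecord F N ν τ E w ppSel p g (k + 1) (s.snoc e) V'| := by
  rw [← sum_filter_lastRegion_eq_sum_extPair
    (fun s' : SeqOfRecord F ν τ.M g p.K (k + 1) => chiSeqOfRecord F N ν τ.M g p.K (k + 1) s' V' * cR s' V' *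
      |slotsTOfRecord F N ν τ E w ppSel p g (k + 1) s' V'|) Z']
  unfold pieceOfRecord
  refine (Finset.abs_sum_le_sum_abs _ _).trans (Finset.sum_le_sum fun s' _ => ?_)
  have hχ0 := chiSeqOfRecord_nonneg F N ν τ.M g p.K (k + 1) s' V'
  rw [abs_mul, abs_of_nonneg hχ0, mul_assoc]
  exact mul_le_mul_of_nonneg_left (hR s') hχ0

open Classical in
/-- **★★★ THE (0.2) PIECE-TO-PIECE STEP** ([IV] (0.3) *«the operation 𝐑𝐓 applied to each term ρ_k(Z,·)»*, kernel form) [PROVED bookkeeping]: with the level-`k` history terms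
`χ_k(s)·slot_k(s) ≥ 0` (r1), measurable (r2), the pieces `ρ_k(Z,·)` bounded (r6), the step-weight row `|w_k(s.snoc e)(U,V′)| ≤ W(Λ_k(s)ᶜ, e)(U,V′)` with `0 ≤ W ≤ 1` measurable in `U` (r3), the
front-factor row `χ_{k+1}(s.snoc e)(V′) ≤ X(e)(V′)` (r4, inhabited with equality by `chiSeqOfRecord_snoc_eq_of_fst_eq`) and the 𝐑-ratio row with `c_R(s.snoc e)(V′) ≤ C(Λ_k(s)ᶜ, e)(V′)` (r5):
`|ρ_{k+1}(Z′,V′)| ≤ Σ_Z Σ_{q : q.1, q.2 ∈ 𝐃_{k+1}, q.2 ⊆ q.1, (1 ≤ k → q.1 ⊆ Zᶜ), q.2ᶜ = Z′} X(q)(V′)·C(Z,q)(V′)·T_k(W(Z,q)(·,V′)·ρ_k(Z,·))(V′)` — the level-`k` pieces enter through their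
transports, summed over LAST REGIONS `Z`; the old histories are summed INSIDE the integral (`transportOfRecord_mul_sum`).  The rows are the DISPLAYED analytic ∕ structural content of one
renormalization step ([III] §3, [IV] §1 (0.3), [B16] (1.89); (r3) a def-T-side structure fact) — LOCATED, nobody's theorem here; nothing of Bałaban's asserted.
[cite: Balaban1989LargeFieldI, (0.2)–(0.4) p.176; Balaban1988Convergent, (2.18) p.257, (3.1) p.264, §3 p.267, (3.24)–(3.25) p.270; Balaban1989LargeFieldII, (1.89) p.387] -/
theorem abs_pieceOfRecord_succ_le_sum_lastRegion_transport_piece (k : ℕ) (Z' : Set (Site (F.P p.K) 0)) (V' : GaugeField (F.P p.K) (k + 1) (SU N))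
    (hpos : ∀ (s : SeqOfRecord F ν τ.M g p.K k) U, 0 ≤ chiSeqOfRecord F N ν τ.M g p.K k s U * slotsOfRecord F N ν τ E w ppSel p g k s U)
    (hmeas : ∀ s : SeqOfRecord F ν τ.M g p.K k,
      Measurable fun U => chiSeqOfRecord F N ν τ.M g p.K k s U * slotsOfRecord F N ν τ E w ppSel p g k s U)
    (hbdd : ∀ Z : Set (Site (F.P p.K) 0), ∃ CZ : ℝ, ∀ U, pieceOfRecord F N ν τ.M (slotsOfRecord F N ν τ E w ppSel) p g k Z U ≤ CZ)
    (W : Set (Site (F.P p.K) 0) → Set (Site (F.P p.K) 0) × Set (Site (F.P p.K) 0) →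
      GaugeField (F.P p.K) k (SU N) → GaugeField (F.P p.K) (k + 1) (SU N) → ℝ)
    (hWm : ∀ Z q, Measurable fun U => W Z q U V') (hW0 : ∀ Z q U, 0 ≤ W Z q U V') (hW1 : ∀ Z q U, W Z q U V' ≤ 1)
    (hW : ∀ (s : SeqOfRecord F ν τ.M g p.K k) (e : Seq.ExtPair (DOfRecord F ν τ.M g p.K) k s) U,
      |w p g k (s.snoc e) U V'| ≤ W ((s.Λ k)ᶜ) e.1 U V')
    (X : Set (Site (F.P p.K) 0) × Set (Site (F.P p.K) 0) → GaugeField (F.P p.K) (k + 1) (SU N) → ℝ)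
    (hX : ∀ (s : SeqOfRecord F ν τ.M g p.K k) (e : Seq.ExtPair (DOfRecord F ν τ.M g p.K) k s),
      chiSeqOfRecord F N ν τ.M g p.K (k + 1) (s.snoc e) V' ≤ X e.1 V')
    (cR : SeqOfRecord F ν τ.M g p.K (k + 1) → GaugeField (F.P p.K) (k + 1) (SU N) → ℝ) (hcR : ∀ s', 0 ≤ cR s' V')
    (hR : ∀ s', |slotsOfRecord F N ν τ E w ppSel p g (k + 1) s' V'| ≤ cR s' V' * |slotsTOfRecord F N ν τ E w ppSel p g (k + 1) s' V'|)
    (C : Set (Site (F.P p.K) 0) → Set (Site (F.P p.K) 0) × Set (Site (F.P p.K) 0) → GaugeField (F.P p.K) (k + 1) (SU N) → ℝ)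
    (hC : ∀ (s : SeqOfRecord F ν τ.M g p.K k) (e : Seq.ExtPair (DOfRecord F ν τ.M g p.K) k s), cR (s.snoc e) V' ≤ C ((s.Λ k)ᶜ) e.1 V') :
    |pieceOfRecord F N ν τ.M (slotsOfRecord F N ν τ E w ppSel) p g (k + 1) Z' V'|
      ≤ ∑ Z : Set (Site (F.P p.K) 0), ∑ q ∈ Finset.univ.filter (fun q : Set (Site (F.P p.K) 0) × Set (Site (F.P p.K) 0) =>
            (q.1 ∈ DOfRecord F ν τ.M g p.K (k + 1) ∧ q.2 ∈ DOfRecord F ν τ.M g p.K (k + 1) ∧ q.2 ⊆ q.1 ∧ (1 ≤ k → q.1 ⊆ Zᶜ)) ∧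
              (q.2)ᶜ = Z'),
          X q V' * C Z q V' *
            transportOfRecord F N p.K k (fun U => W Z q U V' * pieceOfRecord F N ν τ.M (slotsOfRecord F N ν τ E w ppSel) p g k Z U) V' := by
  letI : ∀ s : SeqOfRecord F ν τ.M g p.K k, Fintype (Seq.ExtPair (DOfRecord F ν τ.M g p.K) k s) := fun s => Seq.extPairFintype s
  -- the history term at level `k` and its one-summand bound by the piece
  have hhist_le_piece : ∀ (s : SeqOfRecord F ν τ.M g p.K k) U,
      chiSeqOfRecord F N ν τ.M g p.K k s U * slotsOfRecord F N ν τ E w ppSel p g k s U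
        ≤ pieceOfRecord F N ν τ.M (slotsOfRecord F N ν τ E w ppSel) p g k ((s.Λ k)ᶜ) U := by
    intro s U
    unfold pieceOfRecord
    exact Finset.single_le_sum (f := fun t : SeqOfRecord F ν τ.M g p.K k =>
        chiSeqOfRecord F N ν τ.M g p.K k t U * slotsOfRecord F N ν τ E w ppSel p g k t U)
      (fun t _ => hpos t U) (Finset.mem_filter.mpr ⟨Finset.mem_univ _, rfl⟩)
  -- (i) against `|slotT|`, regrouped; (ii) per `(s, e)`: rows (r4), (r5) and the domination of the transport by (r3)
  have hstep : ∀ (s : SeqOfRecord F ν τ.M g p.K k) (e : Seq.ExtPair (DOfRecord F ν τ.M g p.K) k s),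
      chiSeqOfRecord F N ν τ.M g p.K (k + 1) (s.snoc e) V' * cR (s.snoc e) V' *
          |slotsTOfRecord F N ν τ E w ppSel p g (k + 1) (s.snoc e) V'|
        ≤ X e.1 V' * C ((s.Λ k)ᶜ) e.1 V' *
          transportOfRecord F N p.K k (fun U => W ((s.Λ k)ᶜ) e.1 U V' *
            (chiSeqOfRecord F N ν τ.M g p.K k s U * slotsOfRecord F N ν τ E w ppSel p g k s U)) V' := by
    intro s e
    obtain ⟨CZ, hCZ⟩ := hbdd ((s.Λ k)ᶜ)
    have hχ0 := chiSeqOfRecord_nonneg F N ν τ.M g p.K (k + 1) (s.snoc e) V'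
    have hX0 : 0 ≤ X e.1 V' := hχ0.trans (hX s e)
    have hT : |slotsTOfRecord F N ν τ E w ppSel p g (k + 1) (s.snoc e) V'|
        ≤ transportOfRecord F N p.K k (fun U => W ((s.Λ k)ᶜ) e.1 U V' *
            (chiSeqOfRecord F N ν τ.M g p.K k s U * slotsOfRecord F N ν τ E w ppSel p g k s U)) V' := by
      rw [slotsTOfRecord_succ, tstepOfRecord_apply]
      simp only [Seq.init_snoc]
      refine abs_transportOfRecord_le F N p.K k (fun U => ?_) ((hWm _ _).mul (hmeas s)) (C := 1 * CZ) (fun U => ?_) V'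
      · rw [abs_mul]
        exact mul_le_mul (hW s e U) (le_of_eq (abs_of_nonneg (hpos s U))) (abs_nonneg _) (hW0 _ _ U)
      · exact mul_le_mul (hW1 _ _ U) ((hhist_le_piece s U).trans (hCZ U)) (hpos s U) zero_le_one
    exact mul_le_mul (mul_le_mul (hX s e) (hC s e) (hcR _) hX0) hT (abs_nonneg _) (mul_nonneg hX0 ((hcR _).trans (hC s e)))
  calc |pieceOfRecord F N ν τ.M (slotsOfRecord F N ν τ E w ppSel) p g (k + 1) Z' V'|
      ≤ ∑ s : SeqOfRecord F ν τ.M g p.K k, ∑ e ∈ Finset.univ.filter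
          (fun e : Seq.ExtPair (DOfRecord F ν τ.M g p.K) k s => (e.1.2)ᶜ = Z'),
          chiSeqOfRecord F N ν τ.M g p.K (k + 1) (s.snoc e) V' * cR (s.snoc e) V' *
            |slotsTOfRecord F N ν τ E w ppSel p g (k + 1) (s.snoc e) V'| :=
        abs_pieceOfRecord_succ_le_sum_extPair_abs_slotsT F N ν τ E w ppSel p g k Z' V' cR hR
    _ ≤ ∑ s : SeqOfRecord F ν τ.M g p.K k, ∑ e ∈ Finset.univ.filter
          (fun e : Seq.ExtPair (DOfRecord F ν τ.M g p.K) k s => (e.1.2)ᶜ = Z'),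
          X e.1 V' * C ((s.Λ k)ᶜ) e.1 V' *
            transportOfRecord F N p.K k (fun U => W ((s.Λ k)ᶜ) e.1 U V' *
              (chiSeqOfRecord F N ν τ.M g p.K k s U * slotsOfRecord F N ν τ E w ppSel p g k s U)) V' :=
        Finset.sum_le_sum fun s _ => Finset.sum_le_sum fun e _ => hstep s e
    _ = ∑ Z : Set (Site (F.P p.K) 0), ∑ q ∈ Finset.univ.filter (fun q : Set (Site (F.P p.K) 0) × Set (Site (F.P p.K) 0) =>
            (q.1 ∈ DOfRecord F ν τ.M g p.K (k + 1) ∧ q.2 ∈ DOfRecord F ν τ.M g p.K (k + 1) ∧ q.2 ⊆ q.1 ∧ (1 ≤ k → q.1 ⊆ Zᶜ)) ∧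
              (q.2)ᶜ = Z'),
          ∑ s ∈ Finset.univ.filter (fun s : SeqOfRecord F ν τ.M g p.K k => (s.Λ k)ᶜ = Z),
            X q V' * C Z q V' *
              transportOfRecord F N p.K k (fun U => W Z q U V' *
                (chiSeqOfRecord F N ν τ.M g p.K k s U * slotsOfRecord F N ν τ E w ppSel p g k s U)) V' :=
        sum_extPair_eq_sum_lastRegion_pairs
          (fun Z (s : SeqOfRecord F ν τ.M g p.K k) q => X q V' * C Z q V' *
            transportOfRecord F N p.K k (fun U => W Z q U V' *
              (chiSeqOfRecord F N ν τ.M g p.K k s U * slotsOfRecord F N ν τ E w ppSel p g k s U)) V')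
          (fun q => (q.2)ᶜ = Z')
    _ = _ := by
        refine Finset.sum_congr rfl fun Z _ => Finset.sum_congr rfl fun q _ => ?_
        obtain ⟨CZ, hCZ⟩ := hbdd Z
        rw [← Finset.mul_sum]
        congr 1
        unfold pieceOfRecord
        exact (transportOfRecord_mul_sum F N p.K k _
          (fun (s : SeqOfRecord F ν τ.M g p.K k) U =>
            chiSeqOfRecord F N ν τ.M g p.K k s U * slotsOfRecord F N ν τ E w ppSel p g k s U)
          hpos hmeas (C := CZ) (fun U => by simpa only [pieceOfRecord] using hCZ U) (hWm Z q) (hW0 Z q) (hW1 Z q) V').symm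

end Tower

/-! ## §3. AT K1⁷'s RECORD: (r1) discharged by the ζ-laws of `Provisos₁₃CoPH`; (r2)–(r6) displayed -/

section AtRecord

variable (F : T4Family) (N : ℕ) [NeZero N]
variable (θ : Stage13HParams F N) (P : B12.RunParams)

open Classical in
/-- **★★★ THE (0.2) PIECE-TO-PIECE STEP AT K1⁷'s RECORD** (ν := θ.ν, τ := θ.τ9, E := `EOfRecord₁₃`, w := `wOfRecord₉`, ppSel := θ.ppSel, g := `gOfRecord₁₃`): with (r1) DISCHARGED by
dag-n13-w1's `histTerm_nonneg` (`h.zetaUnity`, `h.zetaAbs`), the level-(k+1) piece of `densOfRecord₁₃` along the run `P` obeys, at every coarse field `V′`,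
`|ρ_{k+1}(Z′,V′)| ≤ Σ_Z Σ_{q : q.1, q.2 ∈ 𝐃_{k+1}, q.2 ⊆ q.1, (1 ≤ k → q.1 ⊆ Zᶜ), q.2ᶜ = Z′} X(q)(V′)·C(Z,q)(V′)·T_k(W(Z,q)(·,V′)·ρ_k(Z,·))(V′)` under the displayed rows (r2) measurability of the level-`k`
history terms, (r6) bounded pieces, (r3) `|w_k(s.snoc e)| ≤ W(Λ_k(s)ᶜ,e)` with `0 ≤ W ≤ 1` measurable, (r4) `χ_{k+1}(s.snoc e) ≤ X(e)` (sharp by `chiSeqOfRecord_snoc_eq_of_fst_eq`), (r5) the 𝐑-ratio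
row with `c_R(s.snoc e) ≤ C(Λ_k(s)ᶜ,e)` (`C := 1` at live selectors).  Nothing of Bałaban's asserted; (U1) NOT proved.
[cite: Balaban1989LargeFieldI, (0.2)–(0.4) p.176; Balaban1988Convergent, (2.18) p.257, (3.1) p.264, §3 p.267, (3.24)–(3.25) p.270; Balaban1989LargeFieldII, (1.89) p.387] -/
theorem abs_pieceOfRecord₁₃_succ_le_sum_lastRegion_transport_piece (h : θ.Provisos₁₃CoPH F N) (k : ℕ) (Z' : Set (Site (F.P P.K) 0))
    (V' : GaugeField (F.P P.K) (k + 1) (SU N))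
    (hmeas : ∀ s : SeqOfRecord F θ.ν θ.τ9.M (gOfRecord₁₃ F N θ.toStage13Params P) P.K k,
      Measurable fun U => chiSeqOfRecord F N θ.ν θ.τ9.M (gOfRecord₁₃ F N θ.toStage13Params P) P.K k s U *
        slotsOfRecord F N θ.ν θ.τ9 (EOfRecord₁₃ F N θ.toStage13Params) (wOfRecord₉ F N θ.toStage9Params) θ.ppSel P
          (gOfRecord₁₃ F N θ.toStage13Params P) k s U)
    (hbdd : ∀ Z : Set (Site (F.P P.K) 0), ∃ CZ : ℝ, ∀ U, pieceOfRecord F N θ.ν θ.τ9.M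
        (slotsOfRecord F N θ.ν θ.τ9 (EOfRecord₁₃ F N θ.toStage13Params) (wOfRecord₉ F N θ.toStage9Params) θ.ppSel)
        P (gOfRecord₁₃ F N θ.toStage13Params P) k Z U ≤ CZ)
    (W : Set (Site (F.P P.K) 0) → Set (Site (F.P P.K) 0) × Set (Site (F.P P.K) 0) →
      GaugeField (F.P P.K) k (SU N) → GaugeField (F.P P.K) (k + 1) (SU N) → ℝ)
    (hWm : ∀ Z q, Measurable fun U => W Z q U V') (hW0 : ∀ Z q U, 0 ≤ W Z q U V') (hW1 : ∀ Z q U, W Z q U V' ≤ 1)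
    (hW : ∀ (s : SeqOfRecord F θ.ν θ.τ9.M (gOfRecord₁₃ F N θ.toStage13Params P) P.K k)
        (e : Seq.ExtPair (DOfRecord F θ.ν θ.τ9.M (gOfRecord₁₃ F N θ.toStage13Params P) P.K) k s) U,
      |wOfRecord₉ F N θ.toStage9Params P (gOfRecord₁₃ F N θ.toStage13Params P) k (s.snoc e) U V'| ≤ W ((s.Λ k)ᶜ) e.1 U V')
    (X : Set (Site (F.P P.K) 0) × Set (Site (F.P P.K) 0) → GaugeField (F.P P.K) (k + 1) (SU N) → ℝ)
    (hX : ∀ (s : SeqOfRecord F θ.ν θ.τ9.M (gOfRecord₁₃ F N θ.toStage13Params P) P.K k)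
        (e : Seq.ExtPair (DOfRecord F θ.ν θ.τ9.M (gOfRecord₁₃ F N θ.toStage13Params P) P.K) k s),
      chiSeqOfRecord F N θ.ν θ.τ9.M (gOfRecord₁₃ F N θ.toStage13Params P) P.K (k + 1) (s.snoc e) V' ≤ X e.1 V')
    (cR : SeqOfRecord F θ.ν θ.τ9.M (gOfRecord₁₃ F N θ.toStage13Params P) P.K (k + 1) → GaugeField (F.P P.K) (k + 1) (SU N) → ℝ)
    (hcR : ∀ s', 0 ≤ cR s' V')
    (hR : ∀ s', |slotsOfRecord F N θ.ν θ.τ9 (EOfRecord₁₃ F N θ.toStage13Params) (wOfRecord₉ F N θ.toStage9Params) θ.ppSel P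
          (gOfRecord₁₃ F N θ.toStage13Params P) (k + 1) s' V'| ≤
        cR s' V' * |slotsTOfRecord F N θ.ν θ.τ9 (EOfRecord₁₃ F N θ.toStage13Params) (wOfRecord₉ F N θ.toStage9Params) θ.ppSel P
          (gOfRecord₁₃ F N θ.toStage13Params P) (k + 1) s' V'|)
    (C : Set (Site (F.P P.K) 0) → Set (Site (F.P P.K) 0) × Set (Site (F.P P.K) 0) → GaugeField (F.P P.K) (k + 1) (SU N) → ℝ)
    (hC : ∀ (s : SeqOfRecord F θ.ν θ.τ9.M (gOfRecord₁₃ F N θ.toStage13Params P) P.K k)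
        (e : Seq.ExtPair (DOfRecord F θ.ν θ.τ9.M (gOfRecord₁₃ F N θ.toStage13Params P) P.K) k s), cR (s.snoc e) V' ≤ C ((s.Λ k)ᶜ) e.1 V') :
    |pieceOfRecord F N θ.ν θ.τ9.M
        (slotsOfRecord F N θ.ν θ.τ9 (EOfRecord₁₃ F N θ.toStage13Params) (wOfRecord₉ F N θ.toStage9Params) θ.ppSel)
        P (gOfRecord₁₃ F N θ.toStage13Params P) (k + 1) Z' V'|
      ≤ ∑ Z : Set (Site (F.P P.K) 0), ∑ q ∈ Finset.univ.filter (fun q : Set (Site (F.P P.K) 0) × Set (Site (F.P P.K) 0) =>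
            (q.1 ∈ DOfRecord F θ.ν θ.τ9.M (gOfRecord₁₃ F N θ.toStage13Params P) P.K (k + 1) ∧
              q.2 ∈ DOfRecord F θ.ν θ.τ9.M (gOfRecord₁₃ F N θ.toStage13Params P) P.K (k + 1) ∧ q.2 ⊆ q.1 ∧ (1 ≤ k → q.1 ⊆ Zᶜ)) ∧
              (q.2)ᶜ = Z'),
          X q V' * C Z q V' *
            transportOfRecord F N P.K k (fun U => W Z q U V' * pieceOfRecord F N θ.ν θ.τ9.M
              (slotsOfRecord F N θ.ν θ.τ9 (EOfRecord₁₃ F N θ.toStage13Params) (wOfRecord₉ F N θ.toStage9Params) θ.ppSel)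
              P (gOfRecord₁₃ F N θ.toStage13Params P) k Z U) V' :=
  abs_pieceOfRecord_succ_le_sum_lastRegion_transport_piece F N θ.ν θ.τ9 (EOfRecord₁₃ F N θ.toStage13Params) (wOfRecord₉ F N θ.toStage9Params)
    θ.ppSel P (gOfRecord₁₃ F N θ.toStage13Params P) k Z' V'
    (fun s U => histTerm_nonneg θ.toStage13Params h.zetaUnity h.zetaAbs P k s U) hmeas hbdd W hWm hW0 hW1 hW X hX cR hcR hR C hC

end AtRecord

end Summit.QuantumFields.YangMills.BalabanUVNodes.N13U1PieceToPieceStepAtRecord13CoPH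

end
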